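import Summits.HodgeConjecture.CorCM.PairFlipSexticFrame
import Summits.HodgeConjecture.CorCM.SexticCMFourTypesSignRelation
import Literature.NumberTheory.ComplexMultiplication.CMTypeBasic
import HarnessLib

/-!
# COR-CM — four pairwise inequivalent CM types of a pair-flip sextic CM field are in NORMAL FORM for a suitable
# half-system: the codimension-2 reduction of the Hodge conjecture for all products of powers, for ANY four types

Cell `pub-hodgecm2` (COR-CM), binder seat b25 (gen 37); COUNT-NEUTRAL own lane (W-b of B01-SIZE §4 T2); theorems only
plus two small Boolean bookkeeping definitions (`majFalse`, `normPlace`); no named fact, no `sorry`.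
Removes the «normal form» hypothesis `hΦ` of `CorCM/PairFlipSexticFourCoreIntrinsic.lean`: given realisations of ANY
four pairwise inequivalent CM types `Φ₀, …, Φ₃` of `K` (`Φ_a ≠ Φ_b` and `Φ_a ≠ Φ̄_b` for `a ≠ b` — the hypothesis of
p2's `exists_exceptional_two_biproduct_of_finrank_eq_six`, which LOCATES the exceptional `(2,2)`-class), a half-system
`t` enumerating `Φ₀` in the right order puts the four types in normal form after replacing each `Φ_b` with two sign
changes by its conjugate `Φ̄_b = CMTypeOps.bar Φ_b` (realised on the SAME abelian variety by the twisted action,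
`IsCMTypeRealisation.comp_complexConj`).  Since `K` has exactly eight CM types forming four conjugate pairs, these are
ALL the simple abelian threefolds with CM by `K` up to isogeny when `[L:ℚ] ∈ {24, 48}`.

* `mem_phi_iff` — the sign table of the model type `phi` (decide);
* `normalForm_spec`, `normPlace_ne_of_ne` — the Boolean normal form of a sign vector `σ ∉ {(+,+,+), (−,−,−)}`: after
  an optional global flip (`majFalse σ`) it is `−` at exactly one place `normPlace σ`; inequivalent vectors have
  different places (decide);
* **`hodgeConjectureFor_biproduct_comp_of_hodgeClasses_two_of_pairwise_ne`** — `K` sextic CM with normal closure of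
  degree `24` or `48`, `A₄ b ⊨ (K; Φ₄ b)` for four pairwise inequivalent CM types: **if every rational `(2,2)`-class of
  `X₀ × X₁ × X₂ × X₃` is algebraic, then the Hodge conjecture holds for every product of powers `⨁_j A₄ (κ j)`** (and,
  `…_of_avDominatedBy_…`, for everything such a product dominates).
HONEST FRAMING: a reduction; `HC_CM`, `PerL`, `PerLFace` are neither used nor proved.
[cite: Pohlmann1968, Thm 1] [cite: GaoUllmo2025, Thm 3.1] [cite: Deligne1982HodgeCycles, §5 (b)] [cite: Dodson1984, §5.1]

References: [Pohlmann1968] H. Pohlmann, Ann. of Math. 88 (1968), Thm 1; [GaoUllmo2025] Z. Gao, E. Ullmo, J. Inst. Math.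
Jussieu 25 (2025), Thm 3.1; [Deligne1982HodgeCycles] P. Deligne, LNM 900 (1982), §5 (b); [Dodson1984] Trans. AMS 283, §5.1.
-/

noncomputable section

open CategoryTheory CategoryTheory.Limits NumberField

namespace Summit.HodgeConjecture.CorCM.PairFlipSexticFourCore

open Literature.AlgebraicGeometry Literature.AlgebraicGeometry.Motives Literature.AlgebraicGeometry.HodgeTheory
open Literature.AlgebraicGeometry.ComplexMultiplication (IsCMTypeRealisation)
open Literature.AlgebraicTopology.SingularHomology
open Literature.NumberTheory.ComplexMultiplication
open Summit.HodgeConjecture.CorCM.GenericCMField (two_mul_ncard_cmType conjugate_mem_of_not_mem)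
open Summit.HodgeConjecture.CorCM.Census.PairFlipSexticFourCore (Pt phi flipAt)

/-! ## §1 Boolean bookkeeping: the sign table of `phi` and the normal form of a sign vector -/

/-- **The sign table of the model type**: `(b, q, s) ∈ phi` iff `s` is `+` except at the place `b − 1` of the factor
`b ≥ 1`. [folklore] -/
theorem mem_phi_iff : ∀ (b : Fin 4) (q : ZMod 3) (s : Bool),
    ((b, q, s) : Pt) ∈ phi ↔ s = (decide (b = 0) || !decide (q.val + 1 = b.val)) := by
  decide

/-- A sign vector has at least two `−`. [folklore] -/
def majFalse (σ : Bool × Bool × Bool) : Bool := (!σ.1 && !σ.2.1) || (!σ.1 && !σ.2.2) || (!σ.2.1 && !σ.2.2)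

/-- The place of the unique `−` of the sign vector after the optional global flip `majFalse`. [folklore] -/
def normPlace (σ : Bool × Bool × Bool) : ZMod 3 :=
  bif !(xor σ.1 (majFalse σ)) then 0 else bif !(xor σ.2.1 (majFalse σ)) then 1 else 2

/-- **Normal form of a sign vector** `σ ∉ {(+,+,+), (−,−,−)}`: after the optional global flip it is `−` exactly at
`normPlace σ` (finite check). [folklore] -/
theorem normalForm_spec : ∀ σ : Bool × Bool × Bool, σ ≠ (true, true, true) → σ ≠ (false, false, false) →
    ∀ q : ZMod 3, (xor (flipAt σ q) (majFalse σ) = false ↔ q = normPlace σ) := by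
  decide

/-- Inequivalent sign vectors (different and not opposite) have different normal places (finite check). [folklore] -/
theorem normPlace_ne_of_ne : ∀ σ σ' : Bool × Bool × Bool, σ ≠ (true, true, true) → σ ≠ (false, false, false) →
    σ' ≠ (true, true, true) → σ' ≠ (false, false, false) → σ ≠ σ' → σ ≠ (!σ'.1, !σ'.2.1, !σ'.2.2) →
    normPlace σ ≠ normPlace σ' := by
  decide

/-! ## §2 The normal form of four pairwise inequivalent types -/

section NormalForm

variable {K : Type} [Field K] [NumberField K] [IsCMField K] (h6 : Module.finrank ℚ K = 6)

omit [IsCMField K] in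
/-- **Normal form.**  For four pairwise different, pairwise non-conjugate CM types `Φ₄` of the sextic CM field `K` there
are a half-system `t` (three embeddings, pairwise different and pairwise non-conjugate) and sign changes `m` with
`m 0 = false` such that the types `Φ₄ b` (`m b = false`) resp. `Φ̄₄ b = bar (Φ₄ b)` (`m b = true`) are in normal form:
read through the frame `frameOf h6 t`, membership is membership in the model type `phi`.  Construction: enumerate
`Φ₄ 0 = {x 0, x 1, x 2}`; conjugate each `Φ₄ b` with two sign changes relative to `x` (`majFalse`); reorder the places
so that `Φ₄ b` changes sign exactly at `b − 1` (`normPlace`, `normPlace_ne_of_ne`). [cite: Dodson1984, §5.1]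
[cite: Deligne1982HodgeCycles, §5 (b)] -/
theorem exists_normalForm {Φ₄ : Fin 4 → CMType K}
    (hne : ∀ a b : Fin 4, a ≠ b → ∃ s, ¬ (s ∈ (Φ₄ a).1 ↔ s ∈ (Φ₄ b).1))
    (hnc : ∀ a b : Fin 4, a ≠ b → ∃ s, ¬ (s ∈ (Φ₄ a).1 ↔ s ∉ (Φ₄ b).1)) :
    ∃ (t : ZMod 3 → (K →+* ℂ)) (ht : Function.Injective t) (htc : ∀ p q, t p ≠ ComplexEmbedding.conjugate (t q))
      (m : Fin 4 → Bool), m 0 = false ∧ ∀ (b : Fin 4) (s : K →+* ℂ),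
        s ∈ (if m b then CMTypeOps.bar (Φ₄ b) else Φ₄ b).1 ↔
          ((b, (frameOf h6 t ht htc s).1, (frameOf h6 t ht htc s).2) : Pt) ∈ phi := by
  classical
  -- ### enumerate `Φ₄ 0 = {x 0, x 1, x 2}`
  have h3 : (Φ₄ 0).1.ncard = 3 := by have := two_mul_ncard_cmType (Φ₄ 0); omega
  obtain ⟨s₀, s₁, s₂, h01, h02, h12, hΦ0⟩ := Set.ncard_eq_three.1 h3
  let x : ZMod 3 → (K →+* ℂ) := fun p => if p = 0 then s₀ else if p = 1 then s₁ else s₂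
  have hx0 : x 0 = s₀ := by
    show (if (0 : ZMod 3) = 0 then s₀ else if (0 : ZMod 3) = 1 then s₁ else s₂) = s₀
    rw [if_pos rfl]
  have hx1 : x 1 = s₁ := by
    show (if (1 : ZMod 3) = 0 then s₀ else if (1 : ZMod 3) = 1 then s₁ else s₂) = s₁
    rw [if_neg (by decide), if_pos rfl]
  have hx2 : x 2 = s₂ := by
    show (if (2 : ZMod 3) = 0 then s₀ else if (2 : ZMod 3) = 1 then s₁ else s₂) = s₂
    rw [if_neg (by decide), if_neg (by decide)]
  have hxmem : ∀ p, x p ∈ (Φ₄ 0).1 := fun p => by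
    rcases zmod3_cases p with rfl | rfl | rfl
    · rw [hx0, hΦ0]; simp
    · rw [hx1, hΦ0]; simp
    · rw [hx2, hΦ0]; simp
  have hxinj : Function.Injective x := by
    intro p q hpq
    rcases zmod3_cases p with rfl | rfl | rfl <;> rcases zmod3_cases q with rfl | rfl | rfl <;>
      simp only [hx0, hx1, hx2] at hpq <;>
      first
        | rfl
        | exact absurd hpq h01
        | exact absurd hpq h02
        | exact absurd hpq h12
        | exact absurd hpq.symm h01
        | exact absurd hpq.symm h02
        | exact absurd hpq.symm h12
  have hxc : ∀ p q, x p ≠ ComplexEmbedding.conjugate (x q) := fun p q h =>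
    ((Φ₄ 0).2 (x q)).1 (hxmem q) (h ▸ hxmem p)
  -- every embedding is an `x p` or an `(x p)‾`
  have hcover : ∀ s : K →+* ℂ, ∃ p, s = x p ∨ s = ComplexEmbedding.conjugate (x p) := fun s => by
    obtain ⟨⟨p, b⟩, hy⟩ : ∃ y, (frameOf h6 x hxinj hxc).symm y = s := ⟨_, Equiv.symm_apply_apply _ s⟩
    refine ⟨p, ?_⟩
    rw [← hy, frameOf_symm_apply]
    cases b
    · exact Or.inr (by simp)
    · exact Or.inl (by simp)
  -- ### the sign vectors of the four types relative to `x`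
  let sg : Fin 4 → ZMod 3 → Bool := fun b p => @decide (x p ∈ (Φ₄ b).1) (Classical.dec _)
  have hsg : ∀ b p, sg b p = true ↔ x p ∈ (Φ₄ b).1 := fun b p => by simp [sg]
  have hsgc : ∀ b p, ComplexEmbedding.conjugate (x p) ∈ (Φ₄ b).1 ↔ sg b p = false := fun b p => by
    rw [CMTypeOps.conjugate_mem_iff_notMem, ← hsg]; cases sg b p <;> simp
  let σ : Fin 4 → Bool × Bool × Bool := fun b => (sg b 0, sg b 1, sg b 2)
  have hσflip : ∀ b q, flipAt (σ b) q = sg b q := fun b q => by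
    rcases zmod3_cases q with rfl | rfl | rfl <;> rfl
  have hσ0 : σ 0 = (true, true, true) := by
    have h : ∀ p, sg 0 p = true := fun p => (hsg 0 p).2 (hxmem p)
    show (sg 0 0, sg 0 1, sg 0 2) = (true, true, true)
    rw [h, h, h]
  -- two types with the same / opposite sign vectors are equal / conjugate
  have heq_of : ∀ a b, σ a = σ b → ∀ s, (s ∈ (Φ₄ a).1 ↔ s ∈ (Φ₄ b).1) := by
    intro a b hab s
    have hq : ∀ q, sg a q = sg b q := fun q => by rw [← hσflip, ← hσflip, hab]
    obtain ⟨p, rfl | rfl⟩ := hcover s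
    · rw [← hsg, ← hsg, hq]
    · rw [hsgc, hsgc, hq]
  have hconj_of : ∀ a b, σ a = (!(σ b).1, !(σ b).2.1, !(σ b).2.2) → ∀ s, (s ∈ (Φ₄ a).1 ↔ s ∉ (Φ₄ b).1) := by
    intro a b hab s
    have hq : ∀ q, sg a q = !(sg b q) := fun q => by
      rw [← hσflip, ← hσflip, hab]
      rcases zmod3_cases q with rfl | rfl | rfl <;> rfl
    obtain ⟨p, rfl | rfl⟩ := hcover s
    · rw [← hsg, hq, ← hsg]; cases sg b p <;> simp
    · rw [hsgc, hq, CMTypeOps.conjugate_mem_iff_notMem, not_not, ← hsg]; cases sg b p <;> simp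
  have hσne : ∀ a b : Fin 4, a ≠ b → σ a ≠ σ b := fun a b hab h => by
    obtain ⟨s, hs⟩ := hne a b hab; exact hs (heq_of a b h s)
  have hσnc : ∀ a b : Fin 4, a ≠ b → σ a ≠ (!(σ b).1, !(σ b).2.1, !(σ b).2.2) := fun a b hab h => by
    obtain ⟨s, hs⟩ := hnc a b hab; exact hs (hconj_of a b h s)
  have hT : ∀ b : Fin 4, b ≠ 0 → σ b ≠ (true, true, true) := fun b hb h => hσne b 0 hb (h.trans hσ0.symm)
  have hF : ∀ b : Fin 4, b ≠ 0 → σ b ≠ (false, false, false) := fun b hb h =>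
    hσnc b 0 hb (by rw [h, hσ0]; rfl)
  -- ### the reordered half-system `t q = x (π q)`, `π (b - 1) = normPlace (σ b)`
  let π : ZMod 3 → ZMod 3 := fun q => if q = 0 then normPlace (σ 1) else if q = 1 then normPlace (σ 2)
    else normPlace (σ 3)
  have hπ0 : π 0 = normPlace (σ 1) := by
    show (if (0 : ZMod 3) = 0 then normPlace (σ 1) else if (0 : ZMod 3) = 1 then normPlace (σ 2)
      else normPlace (σ 3)) = _
    rw [if_pos rfl]
  have hπ1 : π 1 = normPlace (σ 2) := by
    show (if (1 : ZMod 3) = 0 then normPlace (σ 1) else if (1 : ZMod 3) = 1 then normPlace (σ 2)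
      else normPlace (σ 3)) = _
    rw [if_neg (by decide), if_pos rfl]
  have hπ2 : π 2 = normPlace (σ 3) := by
    show (if (2 : ZMod 3) = 0 then normPlace (σ 1) else if (2 : ZMod 3) = 1 then normPlace (σ 2)
      else normPlace (σ 3)) = _
    rw [if_neg (by decide), if_neg (by decide)]
  have hπne01 : π 0 ≠ π 1 := by
    rw [hπ0, hπ1]; exact normPlace_ne_of_ne _ _ (hT 1 (by decide)) (hF 1 (by decide)) (hT 2 (by decide))
      (hF 2 (by decide)) (hσne 1 2 (by decide)) (hσnc 1 2 (by decide))
  have hπne02 : π 0 ≠ π 2 := by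
    rw [hπ0, hπ2]; exact normPlace_ne_of_ne _ _ (hT 1 (by decide)) (hF 1 (by decide)) (hT 3 (by decide))
      (hF 3 (by decide)) (hσne 1 3 (by decide)) (hσnc 1 3 (by decide))
  have hπne12 : π 1 ≠ π 2 := by
    rw [hπ1, hπ2]; exact normPlace_ne_of_ne _ _ (hT 2 (by decide)) (hF 2 (by decide)) (hT 3 (by decide))
      (hF 3 (by decide)) (hσne 2 3 (by decide)) (hσnc 2 3 (by decide))
  have hπinj : Function.Injective π := fun p q hpq => by
    rcases zmod3_cases p with rfl | rfl | rfl <;> rcases zmod3_cases q with rfl | rfl | rfl <;>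
      first
        | rfl
        | exact absurd hpq hπne01
        | exact absurd hpq hπne02
        | exact absurd hpq hπne12
        | exact absurd hpq.symm hπne01
        | exact absurd hpq.symm hπne02
        | exact absurd hpq.symm hπne12
  let t : ZMod 3 → (K →+* ℂ) := fun q => x (π q)
  have ht : Function.Injective t := hxinj.comp hπinj
  have htc : ∀ p q, t p ≠ ComplexEmbedding.conjugate (t q) := fun p q => hxc (π p) (π q)
  -- ### the normalised types (conjugate the types with two sign changes)
  let Φ' : Fin 4 → CMType K := fun b => if majFalse (σ b) then CMTypeOps.bar (Φ₄ b) else Φ₄ b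
  -- membership in `Φ' b` read on `x`: `x p ∈ Φ' b ↔ xor (sg b p) (majFalse (σ b)) = true`
  have hmem' : ∀ b p, x p ∈ (Φ' b).1 ↔ xor (sg b p) (majFalse (σ b)) = true := fun b p => by
    by_cases hm : majFalse (σ b) = true
    · simp only [Φ', hm, ↓reduceIte]
      rw [CMTypeOps.mem_bar_iff, ← hsg]; cases sg b p <;> simp
    · have hm' : majFalse (σ b) = false := by cases h : majFalse (σ b) <;> simp_all
      simp only [Φ', hm', Bool.false_eq_true, ↓reduceIte]
      rw [← hsg]; cases sg b p <;> simp
  -- ### the normal form: `s ∈ Φ' b ↔ (b, frameOf t s) ∈ phi`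
  have hΦ' : ∀ (b : Fin 4) (s : K →+* ℂ),
      s ∈ (Φ' b).1 ↔ ((b, (frameOf h6 t ht htc s).1, (frameOf h6 t ht htc s).2) : Pt) ∈ phi := by
    intro b s
    obtain ⟨⟨q, sgn⟩, hy⟩ : ∃ y, (frameOf h6 t ht htc).symm y = s := ⟨_, Equiv.symm_apply_apply _ s⟩
    rw [← hy, Equiv.apply_symm_apply, frameOf_symm_apply, mem_phi_iff]
    -- the key: `t q ∈ Φ' b ↔ (b = 0 ∨ q ≠ b - 1)`
    have key : t q ∈ (Φ' b).1 ↔ (decide (b = 0) || !decide (q.val + 1 = b.val)) = true := by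
      change x (π q) ∈ (Φ' b).1 ↔ _
      rw [hmem' b (π q)]
      by_cases hb : b = 0
      · subst hb
        have hm0 : majFalse (σ 0) = false := by rw [hσ0]; rfl
        rw [hm0, (hsg 0 (π q)).2 (hxmem _)]
        simp
      · have hnf := normalForm_spec (σ b) (hT b hb) (hF b hb) (π q)
        rw [hσflip] at hnf
        -- `xor … = true ↔ π q ≠ normPlace (σ b) ↔ q ≠ b - 1`
        have hplace : π q = normPlace (σ b) ↔ q.val + 1 = b.val := by
          have hb' : b = 1 ∨ b = 2 ∨ b = 3 :=
            (show ∀ b : Fin 4, b ≠ 0 → b = 1 ∨ b = 2 ∨ b = 3 by decide) b hb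
          rcases hb' with rfl | rfl | rfl
          · rw [← hπ0, hπinj.eq_iff]
            rcases zmod3_cases q with rfl | rfl | rfl <;> decide
          · rw [← hπ1, hπinj.eq_iff]
            rcases zmod3_cases q with rfl | rfl | rfl <;> decide
          · rw [← hπ2, hπinj.eq_iff]
            rcases zmod3_cases q with rfl | rfl | rfl <;> decide
        rw [show (decide (b = 0) || !decide (q.val + 1 = b.val)) = !decide (q.val + 1 = b.val) by
          rw [decide_eq_false hb, Bool.false_or]]
        constructor
        · intro h
          cases hd : decide (q.val + 1 = b.val)
          · rfl
          · exact absurd (hnf.2 (hplace.2 (of_decide_eq_true hd))) (by rw [h]; decide)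
        · intro h
          cases hv : xor (sg b (π q)) (majFalse (σ b))
          · have hq := hplace.1 (hnf.1 hv)
            rw [decide_eq_true hq] at h
            exact absurd h (by decide)
          · rfl
    cases sgn
    · -- `s = (t q)‾`
      simp only [Bool.false_eq_true, ↓reduceIte]
      rw [CMTypeOps.conjugate_mem_iff_notMem, key]
      cases (decide (b = 0) || !decide (q.val + 1 = b.val)) <;> simp
    · simp only [↓reduceIte]
      rw [key, eq_comm]
  have hm0 : majFalse (σ 0) = false := by rw [hσ0]; rfl
  exact ⟨t, ht, htc, fun b => majFalse (σ b), hm0, hΦ'⟩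

/-- **Twisting a realisation by complex conjugation** (optional): `(A, ι ∘ 𝓞(c), θ ∘ c)` realises the conjugate type
`bar Φ` on the SAME abelian variety (`IsCMTypeRealisation.comp_complexConj`). [cite: Deligne1982HodgeCycles, §5 (b)] -/
theorem isCMTypeRealisation_twist {Φ : CMType K} {A : AbelianVariety ℂ} {ι : 𝓞 K →+* End A}
    {θ : K →+* Module.End ℂ (complexBetti A.X 1)} (h : IsCMTypeRealisation Φ A ι θ) (m : Bool) :
    IsCMTypeRealisation (if m then CMTypeOps.bar Φ else Φ) A
      (if m then ι.comp (RingOfIntegers.mapRingHom (IsCMField.complexConj K).toRingEquiv.toRingHom) else ι)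
      (if m then θ.comp (IsCMField.complexConj K).toRingEquiv.toRingHom else θ) := by
  cases m
  · exact h
  · exact h.comp_complexConj fun φ =>
      (CMTypeOps.mem_bar_iff Φ φ).trans (CMTypeOps.conjugate_mem_iff_notMem Φ φ).symm

variable (L : Type) [Field L] [NumberField L] [IsNormalClosure ℚ K L]
  (hL : Module.finrank ℚ L = 24 ∨ Module.finrank ℚ L = 48)

include h6 hL in
/-- **Frame data for ANY four pairwise inequivalent realisations.**  `K` sextic CM with normal closure of degree `24`
or `48`, `A₄ b ⊨ (K; Φ₄ b)` with `Φ₄` pairwise different and pairwise non-conjugate.  Then there are a model frame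
`e : Hom(K, ℂ) ≃ ZMod 3 × Bool` and realisations `(Φ' b, ι' b, θ' b)` on the SAME abelian varieties `A₄ b` satisfying
ALL the frame hypotheses of `hodgeConjectureFor_biproduct_comp_of_faces` / `…_of_hodgeClasses_two`
(`CorCM/PairFlipSexticFourCoreTransfer.lean`, `…CodimTwo.lean`): `he_conj` (`frameOf_conj`), `he_gal` (the 24 frame
maps are realised by `Aut(ℂ)`: `realised_rotate_flipAt`, from the pair flips of `K`) and the normal form `hΦ`.  This is
the adapter that turns every frame-form theorem about the four cores into a statement about any four pairwise
non-isogenous CM threefolds with CM by `K`. [cite: Dodson1984, §5.1] [cite: Deligne1982HodgeCycles, §5 (b)]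
[cite: Shimura1998, §8.4] -/
theorem exists_frame_normalForm {A₄ : Fin 4 → AbelianVariety ℂ} {Φ₄ : Fin 4 → CMType K}
    {ι₄ : ∀ b : Fin 4, 𝓞 K →+* End (A₄ b)} {θ₄ : ∀ b : Fin 4, K →+* Module.End ℂ (complexBetti (A₄ b).X 1)}
    (hA : ∀ b, IsCMTypeRealisation (Φ₄ b) (A₄ b) (ι₄ b) (θ₄ b))
    (hne : ∀ a b : Fin 4, a ≠ b → ∃ s, ¬ (s ∈ (Φ₄ a).1 ↔ s ∈ (Φ₄ b).1))
    (hnc : ∀ a b : Fin 4, a ≠ b → ∃ s, ¬ (s ∈ (Φ₄ a).1 ↔ s ∉ (Φ₄ b).1)) :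
    ∃ (e : (K →+* ℂ) ≃ ZMod 3 × Bool) (Φ' : Fin 4 → CMType K) (ι' : ∀ b : Fin 4, 𝓞 K →+* End (A₄ b))
      (θ' : ∀ b : Fin 4, K →+* Module.End ℂ (complexBetti (A₄ b).X 1)),
      (∀ b, IsCMTypeRealisation (Φ' b) (A₄ b) (ι' b) (θ' b)) ∧
      (∀ s : K →+* ℂ, e (ComplexEmbedding.conjugate s) = ((e s).1, !(e s).2)) ∧
      (∀ (j : ZMod 3) (fl : Bool × Bool × Bool), ∃ σ : ℂ ≃+* ℂ, ∀ s : K →+* ℂ,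
        e ((σ : ℂ →+* ℂ).comp s) = ((e s).1 + j, xor (e s).2 (flipAt fl ((e s).1 + j)))) ∧
      (∀ (b : Fin 4) (s : K →+* ℂ), s ∈ (Φ' b).1 ↔ ((b, (e s).1, (e s).2) : Pt) ∈ phi) := by
  obtain ⟨t, ht, htc, m, -, hΦ'⟩ := exists_normalForm h6 hne hnc
  exact ⟨frameOf h6 t ht htc, _, _, _, fun b => isCMTypeRealisation_twist (hA b) (m b), frameOf_conj h6 t ht htc,
    realised_rotate_flipAt h6 L hL t ht htc, hΦ'⟩

end NormalForm

/-! ## §3 Any four pairwise inequivalent types -/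

section AnyTypes

variable {K : Type} [Field K] [NumberField K] [IsCMField K] (h6 : Module.finrank ℚ K = 6)
  (L : Type) [Field L] [NumberField L] [IsNormalClosure ℚ K L]
  (hL : Module.finrank ℚ L = 24 ∨ Module.finrank ℚ L = 48)
  {N : ℕ} {A₄ : Fin 4 → AbelianVariety ℂ} {Φ₄ : Fin 4 → CMType K} {ι₄ : ∀ b : Fin 4, 𝓞 K →+* End (A₄ b)}
  {θ₄ : ∀ b : Fin 4, K →+* Module.End ℂ (complexBetti (A₄ b).X 1)}

include h6 hL in
/-- **MAIN THEOREM (any four pairwise inequivalent types).**  `K` a sextic CM field with normal closure of degree `24`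
or `48`; `A₄ b ⊨ (K; Φ₄ b)` realisations of four CM types which are pairwise different and pairwise not conjugate
(`hne`, `hnc`; equivalently four pairwise non-isogenous simple abelian threefolds with CM by `K`).  **If every rational
`(2,2)`-class of `X₀ × X₁ × X₂ × X₃ = ⨁ A₄` is algebraic, then `HodgeConjectureFor (⨁_j A₄ (κ j))` for every slot
map `κ`** (`exists_frame_normalForm` + `hodgeConjectureFor_biproduct_comp_of_hodgeClasses_two`). [cite: Pohlmann1968, Thm 1] [cite: GaoUllmo2025, Thm 3.1] [cite: Deligne1982HodgeCycles, §5 (b)] [cite: Dodson1984, §5.1] -/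
theorem hodgeConjectureFor_biproduct_comp_of_hodgeClasses_two_of_pairwise_ne
    (hA : ∀ b, IsCMTypeRealisation (Φ₄ b) (A₄ b) (ι₄ b) (θ₄ b))
    (hne : ∀ a b : Fin 4, a ≠ b → ∃ s, ¬ (s ∈ (Φ₄ a).1 ↔ s ∈ (Φ₄ b).1))
    (hnc : ∀ a b : Fin 4, a ≠ b → ∃ s, ¬ (s ∈ (Φ₄ a).1 ↔ s ∉ (Φ₄ b).1))
    (h2 : ∀ c : complexBetti (⨁ A₄).X (2 * 2), IsRationalClass c →
      IsOfHodgeType (⨁ A₄).dim (⨁ A₄).X (2 * 2) 2 2 c → c ∈ algebraicClasses (⨁ A₄).X 2)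
    (κ : Fin N → Fin 4) :
    HodgeConjectureFor (⨁ fun j => A₄ (κ j)).dim (⨁ fun j => A₄ (κ j)).X := by
  obtain ⟨e, Φ', ι', θ', hA', he_conj, he_gal, hΦ'⟩ := exists_frame_normalForm h6 L hL hA hne hnc
  exact hodgeConjectureFor_biproduct_comp_of_hodgeClasses_two κ hA' he_conj he_gal hΦ' h2

include h6 hL in
/-- **… and for every abelian variety dominated by such a product of powers.** [cite: Milne2020HodgeClassesAV, Thm. 1]
[cite: MumfordAV1970, §19] -/
theorem hodgeConjectureFor_of_avDominatedBy_comp_of_hodgeClasses_two_of_pairwise_ne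
    (hA : ∀ b, IsCMTypeRealisation (Φ₄ b) (A₄ b) (ι₄ b) (θ₄ b))
    (hne : ∀ a b : Fin 4, a ≠ b → ∃ s, ¬ (s ∈ (Φ₄ a).1 ↔ s ∈ (Φ₄ b).1))
    (hnc : ∀ a b : Fin 4, a ≠ b → ∃ s, ¬ (s ∈ (Φ₄ a).1 ↔ s ∉ (Φ₄ b).1))
    (h2 : ∀ c : complexBetti (⨁ A₄).X (2 * 2), IsRationalClass c →
      IsOfHodgeType (⨁ A₄).dim (⨁ A₄).X (2 * 2) 2 2 c → c ∈ algebraicClasses (⨁ A₄).X 2)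
    (κ : Fin N → Fin 4) {B : AbelianVariety ℂ} (hB : Domination.AVDominatedBy B (⨁ fun j => A₄ (κ j))) :
    HodgeConjectureFor B.dim B.X :=
  Domination.hodgeConjectureFor_of_avDominatedBy
    (hodgeConjectureFor_biproduct_comp_of_hodgeClasses_two_of_pairwise_ne h6 L hL hA hne hnc h2 κ) hB

include h6 hL in
/-- **The same with p2's hypothesis shape** (`CorCM/SexticCMFourTypesExceptionalClass.lean`: the four sign vectors
`antiVec (Φ₄ i).1 1` are pairwise different and pairwise not opposite): HC²(`X₀ × X₁ × X₂ × X₃`) ⟹ the Hodge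
conjecture for every product of powers `⨁_j A₄ (κ j)`. [cite: Pohlmann1968, Thm 1] [cite: GaoUllmo2025, Thm 3.1] -/
theorem hodgeConjectureFor_biproduct_comp_of_hodgeClasses_two_of_antiVec_ne
    (hA : ∀ b, IsCMTypeRealisation (Φ₄ b) (A₄ b) (ι₄ b) (θ₄ b))
    (hpair : ∀ i j : Fin 4, i ≠ j → antiVec (Φ₄ j).1 (1 : ℂ ≃+* ℂ) ≠ antiVec (Φ₄ i).1 (1 : ℂ ≃+* ℂ) ∧
      antiVec (Φ₄ j).1 (1 : ℂ ≃+* ℂ) ≠ -antiVec (Φ₄ i).1 (1 : ℂ ≃+* ℂ))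
    (h2 : ∀ c : complexBetti (⨁ A₄).X (2 * 2), IsRationalClass c →
      IsOfHodgeType (⨁ A₄).dim (⨁ A₄).X (2 * 2) 2 2 c → c ∈ algebraicClasses (⨁ A₄).X 2)
    (κ : Fin N → Fin 4) :
    HodgeConjectureFor (⨁ fun j => A₄ (κ j)).dim (⨁ fun j => A₄ (κ j)).X := by
  classical
  have hval : ∀ (Φ : CMType K) (s : K →+* ℂ),
      antiVec Φ.1 (1 : ℂ ≃+* ℂ) s = if s ∈ Φ.1 then 1 else -1 := by
    intro Φ s
    by_cases hs : s ∈ Φ.1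
    · rw [if_pos hs]
      change 2 * translateInd Φ.1 (1 : ℂ ≃+* ℂ) s - 1 = 1
      rw [translateInd_of_mem (by rw [one_smul]; exact hs)]; norm_num
    · rw [if_neg hs]
      change 2 * translateInd Φ.1 (1 : ℂ ≃+* ℂ) s - 1 = -1
      rw [translateInd_of_not_mem (by rw [one_smul]; exact hs)]; norm_num
  refine hodgeConjectureFor_biproduct_comp_of_hodgeClasses_two_of_pairwise_ne h6 L hL hA
    (fun a b hab => ?_) (fun a b hab => ?_) h2 κ
  · by_contra h
    push Not at h
    refine (hpair b a (Ne.symm hab)).1 (funext fun s => ?_)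
    rw [hval, hval]
    by_cases hs : s ∈ (Φ₄ a).1
    · rw [if_pos hs, if_pos ((h s).1 hs)]
    · rw [if_neg hs, if_neg (fun h' => hs ((h s).2 h'))]
  · by_contra h
    push Not at h
    refine (hpair b a (Ne.symm hab)).2 (funext fun s => ?_)
    rw [Pi.neg_apply, hval, hval]
    by_cases hs : s ∈ (Φ₄ a).1
    · rw [if_pos hs, if_neg ((h s).1 hs)]; norm_num
    · rw [if_neg hs, if_pos (not_not.1 fun h' => hs ((h s).2 h'))]

end AnyTypes

end Summit.HodgeConjecture.CorCM.PairFlipSexticFourCore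

end
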